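import Literature.Barriers.ValiantsHypothesis.CT23KroneckerEvaluationPoints
import Literature.Barriers.ValiantsHypothesis.GKSS17FSVPresentation
import Literature.Computability.AlgebraicComplexity.BooleanGadgetPolynomials
import HarnessLib

/-!
# Lemma 3.2's determinant presentation with EXPLICIT (prefix) columns
# (Chatterjee–Tengse arXiv:2309.07612v2, Lemma 3.2 / v1 Lemma 39, "we restrict `M` to its first
# `K` columns"; val-lit p2 g8, X-CT23 engine, preparation of brick E-e′ = Lemma 3.5 / v1 Lemma 42)

Theorem-only (plus three plumbing `def`s) companion of `CT23KroneckerEvaluationPoints.lean`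
(t18 g7, bricks E-e A–D); NO named facts. Honest framing: bookkeeping towards the EXPLICIT
annihilator matrix of the source's §3.2; it discharges nothing by itself; `VP ≠ VNP` is NOT proved
and nothing here bears on it.

## Why this file

`exists_annihilator_eq_det_annMatrix_kronecker` (part D) presents a nonzero annihilator of a
polynomial map `G` as `det M̃` with the printed Kronecker ROWS, but its COLUMN family
`e : Fin (K+1) → box` is an arbitrary injective family (a maximal independent subfamily of the
support of a dimension-count annihilator plus one; disclosed there). The explicit encoder of
Lemma 3.5 (v1 Lemma 42: "`C'(j) = (j^{(1)}, …, j^{(n)})` … the bit-vector encoding the `ℓ`-th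
co-ordinate of `e^{(j)}`") must read the column exponent off the BITS of the column index, so the
columns must be a PREFIX of an explicit enumeration — in print: "we restrict `M` to its first `K`
columns, where `K−1` is the largest number for which the first `K−1` columns are linearly
independent" (v1 p0014.txt:L53–L55). This file proves exactly that form:

* `exists_minimal_dependent_prefix` — a linearly dependent finite SEQUENCE has a shortest dependent
  prefix: its proper prefix is independent and its last vector lies in their span [folklore];
  `not_linearIndependent_of_finrank_lt` — more vectors than the dimension of a finite-dimensional
  subspace containing them are dependent [folklore]; `finrank_restrictTotalDegree` — the space of
  `m`-variate polynomials of total degree `≤ T` has dimension `binom(m+T, T)` (Mathlib's monomial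
  basis of `restrictSupport` + the tree's `GKSS2017.ncard_degLE`).
* `exists_annihilator_eq_det_annMatrix_prefix` — **Lemma 3.2 with Kronecker rows and PREFIX
  columns**: for ANY injective enumeration `exps : Fin N → (Fin n →₀ ℕ)` of exponent vectors whose
  powers `G^{exps j}` have individual degree `< Δ` and are linearly dependent, there are `K`
  (`K+1 ≤ N`) and `α` such that, with columns `exps 0, …, exps K` and rows the evaluations at
  `kronPoint Δ (α^{i+1})` (`i < K`) plus the symbolic row, `det M̃ ≠ 0` and `det M̃ ∘ G = 0`
  (t18's `annMatrix`, `det_annMatrix_ne_zero`, `map_det_annMatrix_eq_zero`,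
  `exists_kronecker_det_eval_ne_zero` by name).
* The BIT-ALIGNED instance used by the encoder (deviation from print, disclosed): the box
  `[D]^{n}` with `D = 2^δ` a POWER OF TWO, enumerated by `n·δ` bits — block `t` of the index IS the
  binary expansion of the digit `e_t` (`blockExp`, little-endian as in the tree's
  `BitGadget.bitsVal`), so NO base-`D` decoding circuit is needed; the dependency comes from the
  TOTAL-degree count `binom(m + n(D−1)d, m) < D^{n}` (`not_linearIndependent_prod_pow_of_choose_lt`)
  instead of the printed box count, and at the parameters of Thm. 3.1 (`n = 2m` outputs, `m ≥ 2`,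
  `d ≥ 1`) the choice `2^δ ≤ 3md < 2^{δ+1}` satisfies it (`choose_lt_pow_of_param`), giving
  individual degree `< 2^δ ≤ 3md` as typed in `CT23_thm_3_1`
  (`exists_prefix_annihilator_blocks`).

## References

* [ChatterjeeTengse2023] P. Chatterjee, A. Tengse, *Lower Bounds from Succinct Hitting Sets*,
  arXiv:2309.07612v2, Lemma 3.2 and its proof, Lemma 3.5 (v1: Lemma 39, p0014.txt:L16–L60;
  Lemma 42, p0015.txt:L57–L102).
* Tree: `CT23AnnihilatorAsDeterminant.lean`, `CT23KroneckerEvaluationPoints.lean` (val-lit t18 g7),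
  `GKSS17FSVPresentation.lean` (`GKSS2017.ncard_degLE`), `BooleanGadgetPolynomials.lean`
  (`BitGadget.bitsVal`, val-lit t24 g9).
-/

noncomputable section

open MvPolynomial Matrix

namespace Literature.Barriers.ValiantsHypothesis

open Literature.Computability.AlgebraicComplexity

universe u

variable {F : Type u} [Field F]

/-! ### Linear algebra: the shortest dependent prefix; dependence by counting dimensions -/

section Prefix

variable {V : Type*} [AddCommGroup V] [Module F V]

omit [AddCommGroup V] [Module F V] in
/-- A prefix of length `K+1` is the prefix of length `K` with the `K`-th vector appended.
[folklore] -/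
private theorem comp_castLE_succ_eq_snoc {N K : ℕ} (v : Fin N → V) (hK : K + 1 ≤ N) :
    v ∘ Fin.castLE hK = Fin.snoc (v ∘ Fin.castLE (Nat.le_of_succ_le hK)) (v ⟨K, hK⟩) := by
  funext j
  induction j using Fin.lastCases with
  | last => rw [Fin.snoc_last]; rfl
  | cast j => rw [Fin.snoc_castSucc]; rfl

/-- **The shortest dependent prefix.** A linearly dependent finite sequence `v_0, …, v_{N−1}` has
an index `K` such that `v_0, …, v_{K−1}` are linearly independent and `v_K` lies in their span
("where `K−1` is the largest number for which the first `K−1` columns are linearly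
independent"). [cite: ChatterjeeTengse2023, proof of Lemma 3.2 (v1: Lemma 39; p0014.txt:L53–L55)] -/
theorem exists_minimal_dependent_prefix {N : ℕ} (v : Fin N → V) (hv : ¬ LinearIndependent F v) :
    ∃ (K : ℕ) (hK : K + 1 ≤ N),
      LinearIndependent F (v ∘ Fin.castLE (Nat.le_of_succ_le hK)) ∧
        v ⟨K, hK⟩ ∈ Submodule.span F (Set.range (v ∘ Fin.castLE (Nat.le_of_succ_le hK))) := by
  classical
  cases N with
  | zero => exact absurd (linearIndependent_empty_type (v := v)) hv
  | succ N =>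
    have hex : ∃ K, ∃ h : K + 1 ≤ N + 1, ¬ LinearIndependent F (v ∘ Fin.castLE h) := by
      refine ⟨N, le_rfl, ?_⟩
      have : v ∘ Fin.castLE (le_refl (N + 1)) = v := funext fun j => congrArg v (Fin.ext rfl)
      rwa [this]
    have hind : ∀ K, K ≤ Nat.find hex → ∀ h : K ≤ N + 1, LinearIndependent F (v ∘ Fin.castLE h) := by
      intro K hK h
      cases K with
      | zero => exact linearIndependent_empty_type
      | succ K' =>
        by_contra hc
        exact Nat.find_min hex (Nat.lt_of_succ_le hK) ⟨h, hc⟩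
    obtain ⟨hK, hdep⟩ := Nat.find_spec hex
    refine ⟨Nat.find hex, hK, hind _ le_rfl _, ?_⟩
    rw [comp_castLE_succ_eq_snoc, linearIndependent_finSnoc, not_and, not_not] at hdep
    exact hdep (hind _ le_rfl _)

/-- **More vectors than dimensions are dependent**: `N > dim W` vectors of a finite-dimensional
subspace `W` are linearly dependent ("`M` has fewer rows than columns … therefore there is a
non-trivial dependency in its columns"). [cite: ChatterjeeTengse2023, proof of Lemma 3.2 (v1: p0014.txt:L50–L52)] -/
theorem not_linearIndependent_of_finrank_lt {N : ℕ} (W : Submodule F V) [Module.Finite F W]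
    (v : Fin N → V) (hv : ∀ j, v j ∈ W) (hN : Module.finrank F W < N) :
    ¬ LinearIndependent F v := by
  intro hli
  have hli' : LinearIndependent F (fun j => (⟨v j, hv j⟩ : W)) :=
    LinearIndependent.of_comp W.subtype (by exact hli)
  have := hli'.fintype_card_le_finrank
  rw [Fintype.card_fin] at this
  omega

end Prefix

/-! ### The dimension of the polynomials of bounded total degree -/

section TotalDegree

/-- The exponents of total degree `≤ T` form a finite set (Mathlib). [folklore] -/
private theorem totalDegreeBox_finite (m T : ℕ) :
    {e : Fin m →₀ ℕ | (e.sum fun _ k => k) ≤ T}.Finite := by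
  have h : {e : Fin m →₀ ℕ | (e.sum fun _ k => k) ≤ T} = {e : Fin m →₀ ℕ | e.degree ≤ T} := by
    ext e; simp [Finsupp.degree_apply, Finsupp.sum]
  rw [h]
  exact Finsupp.finite_of_degree_le T

/-- The polynomials of total degree `≤ T` form a finite-dimensional space. [folklore] -/
private theorem finite_restrictTotalDegree (m T : ℕ) :
    Module.Finite F (restrictTotalDegree (Fin m) F T) := by
  haveI : Finite {e : Fin m →₀ ℕ | (e.sum fun _ k => k) ≤ T} := (totalDegreeBox_finite m T).to_subtype
  exact Module.Finite.of_basis (basisRestrictSupport F _)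

/-- **`dim F[z_1, …, z_m]_{≤ T} = binom(m + T, T)`** (the monomial basis; the source's row count,
here by TOTAL degree). [cite: ChatterjeeTengse2023, proof of Lemma 3.2 (v1: p0014.txt:L46–L52)] -/
theorem finrank_restrictTotalDegree (m T : ℕ) :
    Module.finrank F (restrictTotalDegree (Fin m) F T) = (m + T).choose T := by
  rw [restrictTotalDegree, Module.finrank_eq_nat_card_basis (basisRestrictSupport F _)]
  have h : {e : Fin m →₀ ℕ | (e.sum fun _ k => k) ≤ T} = {e : Fin m →₀ ℕ | e.degree ≤ T} := by
    ext e; simp [Finsupp.degree_apply, Finsupp.sum]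
  rw [h]
  exact GKSS2017.ncard_degLE m T

variable {m n : ℕ}

/-- A product of powers `∏ G_t^{e_t}` with `deg G_t ≤ d` and `e_t < D` has total degree
`≤ n (D−1) d`. [cite: ChatterjeeTengse2023, proof of Lemma 3.2 (v1: p0014.txt:L49–L50)] -/
theorem totalDegree_prod_pow_le_of_lt {d D : ℕ} (G : Fin n → MvPolynomial (Fin m) F)
    (hG : ∀ i, (G i).totalDegree ≤ d) {e : Fin n →₀ ℕ} (he : ∀ t, e t < D) :
    (∏ t, G t ^ e t).totalDegree ≤ n * (D - 1) * d := by
  refine (totalDegree_finsetProd _ _).trans ?_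
  calc ∑ t, (G t ^ e t).totalDegree ≤ ∑ _t : Fin n, (D - 1) * d :=
        Finset.sum_le_sum fun t _ => (totalDegree_pow _ _).trans
          (Nat.mul_le_mul (Nat.le_sub_one_of_lt (he t)) (hG t))
    _ = n * (D - 1) * d := by simp [mul_assoc]

/-- **Dependence by the total-degree count**: if `binom(m + n(D−1)d, n(D−1)d)` (the number of
`m`-variate monomials of total degree `≤ n(D−1)d`) is smaller than the number `N` of enumerated
box exponents, the powers `G^{exps j}` are linearly dependent.
[cite: ChatterjeeTengse2023, proof of Lemma 3.2 (v1: p0014.txt:L46–L52)] -/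
theorem not_linearIndependent_prod_pow_of_choose_lt {d D N : ℕ} (G : Fin n → MvPolynomial (Fin m) F)
    (hG : ∀ i, (G i).totalDegree ≤ d) (exps : Fin N → (Fin n →₀ ℕ)) (hexps : ∀ j t, exps j t < D)
    (hcount : (m + n * (D - 1) * d).choose (n * (D - 1) * d) < N) :
    ¬ LinearIndependent F (fun j => ∏ t, G t ^ exps j t) := by
  haveI := finite_restrictTotalDegree (F := F) m (n * (D - 1) * d)
  refine not_linearIndependent_of_finrank_lt (restrictTotalDegree (Fin m) F (n * (D - 1) * d)) _
    (fun j => ?_) ?_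
  · rw [mem_restrictTotalDegree]
    exact totalDegree_prod_pow_le_of_lt G hG (hexps j)
  · rwa [finrank_restrictTotalDegree]

end TotalDegree

/-! ### Lemma 3.2 with Kronecker rows and PREFIX columns -/

section PrefixColumns

variable {m n : ℕ}

/-- **Lemma 3.2 (v1 Lemma 39), prefix form.** Let `exps : Fin N → (Fin n →₀ ℕ)` be an injective
enumeration of exponent vectors such that the powers `P_j = G^{exps j}` have individual degree
`< Δ` and are linearly dependent. Then for the SHORTEST dependent prefix `P_0, …, P_K` and a
suitable `α`, the matrix `M̃` with rows `P_j(kronPoint Δ (α^{i+1}))` (`i < K`) and the symbolic row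
`x^{exps j}` has `det M̃ ≠ 0` and `(det M̃) ∘ G = 0`.
[cite: ChatterjeeTengse2023, Lemma 3.2, Claims 3.3–3.4 (v1: Lemma 39, Claims 40–41; p0014.txt:L16–L92, p0015.txt:L1–L56)] -/
theorem exists_annihilator_eq_det_annMatrix_prefix [CharZero F] {N Δ : ℕ}
    (G : Fin n → MvPolynomial (Fin m) F) (exps : Fin N → (Fin n →₀ ℕ))
    (hinj : Function.Injective exps)
    (hbox : ∀ j, ∀ c ∈ (∏ t, G t ^ exps j t).support, ∀ b, c b < Δ)
    (hdep : ¬ LinearIndependent F (fun j => ∏ t, G t ^ exps j t)) :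
    ∃ (K : ℕ) (hK : K + 1 ≤ N) (α : F),
      (annMatrix (Matrix.of fun (i : Fin K) (j : Fin (K + 1)) =>
          eval (kronPoint Δ (α ^ ((i : ℕ) + 1))) (∏ t, G t ^ exps (Fin.castLE hK j) t))
        (exps ∘ Fin.castLE hK)).det ≠ 0 ∧
      aeval G (annMatrix (Matrix.of fun (i : Fin K) (j : Fin (K + 1)) =>
          eval (kronPoint Δ (α ^ ((i : ℕ) + 1))) (∏ t, G t ^ exps (Fin.castLE hK j) t))
        (exps ∘ Fin.castLE hK)).det = 0 := by
  classical
  obtain ⟨K, hK, hind, hspan⟩ := exists_minimal_dependent_prefix _ hdep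
  set e : Fin (K + 1) → (Fin n →₀ ℕ) := exps ∘ Fin.castLE hK with he
  set P : Fin (K + 1) → MvPolynomial (Fin m) F := fun j => ∏ t, G t ^ e j t with hP
  have he_inj : Function.Injective e := hinj.comp (Fin.castLE_injective hK)
  have hPcast : P ∘ Fin.castSucc =
      (fun j : Fin N => ∏ t, G t ^ exps j t) ∘ Fin.castLE (Nat.le_of_succ_le hK) := by
    funext j; rfl
  have hPind : LinearIndependent F (P ∘ Fin.castSucc) := by rw [hPcast]; exact hind
  have hPlast : P (Fin.last K) ∈ Submodule.span F (Set.range (P ∘ Fin.castSucc)) := by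
    rw [hPcast]; exact hspan
  obtain ⟨c, hc⟩ := (Submodule.mem_span_range_iff_exists_fun F).1 hPlast
  have hboxP : ∀ j, ∀ c ∈ ((P ∘ Fin.castSucc) j).support, ∀ b, c b < Δ :=
    fun j c hc b => hbox _ c hc b
  obtain ⟨α, hα⟩ := exists_kronecker_det_eval_ne_zero Δ hPind hboxP
  have hPe_mon : ∀ j, aeval G (monomial (e j) (1 : F)) = P j := fun j => by
    rw [aeval_monomial, map_one, one_mul, Finsupp.prod_pow]
  refine ⟨K, hK, α, ?_, ?_⟩
  · refine det_annMatrix_ne_zero _ he_inj (j₀ := Fin.last K) ?_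
    have : (Matrix.of fun (i : Fin K) (j : Fin (K + 1)) =>
          eval (kronPoint Δ (α ^ ((i : ℕ) + 1))) (∏ t, G t ^ exps (Fin.castLE hK j) t)).submatrix
          id (Fin.last K).succAbove =
        Matrix.of fun (i : Fin K) (j : Fin K) =>
          eval (kronPoint Δ (α ^ ((i : ℕ) + 1))) ((P ∘ Fin.castSucc) j) := by
      ext i j; simp [hP, he, Fin.succAbove_last]
    rw [this]; exact hα
  · refine map_det_annMatrix_eq_zero _ e (P := P) (aeval G) hPe_mon
      (p := fun i => kronPoint Δ (α ^ ((i : ℕ) + 1))) (fun i j => rfl)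
      (f := Fin.snoc c (-1)) ?_ (j₀ := Fin.last K) (by simp)
    rw [Fin.sum_univ_castSucc]
    simp only [Fin.snoc_castSucc, Fin.snoc_last, neg_smul, one_smul]
    rw [show (∑ i : Fin K, c i • P (Fin.castSucc i)) = P (Fin.last K) from hc, add_neg_cancel]

end PrefixColumns

/-! ### The bit-aligned enumeration of the box `[2^δ]^n` -/

section Blocks

/-- Block `t` (of width `δ`) of a bit-vector of length `n·δ`.
[cite: ChatterjeeTengse2023, proof of Lemma 3.5 "`j = (j^{(1)}, …, j^{(n)})`" (v1: Lemma 42; p0015.txt:L80–L82)] -/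
def block (n δ : ℕ) (β : Fin (n * δ) → Bool) (t : Fin n) : Fin δ → Bool :=
  fun c => β (finProdFinEquiv (t, c))

/-- **The exponent vector of a column index**: digit `t` is the number encoded (least significant
bit first) by block `t`. [cite: ChatterjeeTengse2023, proof of Lemma 3.5 "the bit-vector encoding the `ℓ`-th co-ordinate of `e^{(j)}`" (v1: Lemma 42; p0015.txt:L80–L82)] -/
def blockExp (n δ : ℕ) (β : Fin (n * δ) → Bool) : Fin n →₀ ℕ :=
  Finsupp.equivFunOnFinite.symm fun t => BitGadget.bitsVal δ (block n δ β t)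

/-- The digits, coordinatewise. [cite: ChatterjeeTengse2023, proof of Lemma 3.5 (v1: Lemma 42; p0015.txt:L80–L82)] -/
@[simp] theorem blockExp_apply (n δ : ℕ) (β : Fin (n * δ) → Bool) (t : Fin n) :
    blockExp n δ β t = BitGadget.bitsVal δ (block n δ β t) := by
  simp [blockExp]

/-- Digits are `< 2^δ`. [cite: ChatterjeeTengse2023, proof of Lemma 3.5 (v1: Lemma 42; p0015.txt:L80–L82)] -/
theorem blockExp_lt (n δ : ℕ) (β : Fin (n * δ) → Bool) (t : Fin n) : blockExp n δ β t < 2 ^ δ := by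
  rw [blockExp_apply]; exact BitGadget.bitsVal_lt_two_pow _ _

/-- Distinct bit-vectors have distinct digit vectors. [cite: ChatterjeeTengse2023, proof of Lemma 3.5 (v1: Lemma 42; p0015.txt:L80–L82)] -/
theorem blockExp_injective (n δ : ℕ) : Function.Injective (blockExp n δ) := by
  intro β β' h
  funext l
  obtain ⟨⟨t, c⟩, rfl⟩ := finProdFinEquiv.surjective l
  have ht : BitGadget.bitsVal δ (block n δ β t) = BitGadget.bitsVal δ (block n δ β' t) := by
    have := congrArg (fun e => e t) h
    simpa using this
  exact congrFun (BitGadget.bitsVal_injective δ ht) c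

/-- **The numeric value of a bit-vector as an index** (`BitGadget.bitsVal`, little-endian), a
bijection `{0,1}^L ≃ Fin 2^L`. [cite: ChatterjeeTengse2023, Def. 2.27 "binary representations of `i`, `j`" (v1: Def. 34; p0011.txt:L82)] -/
def bitsIndex (L : ℕ) : (Fin L → Bool) ≃ Fin (2 ^ L) :=
  Equiv.ofBijective (fun β => ⟨BitGadget.bitsVal L β, BitGadget.bitsVal_lt_two_pow L β⟩) (by
    refine (Fintype.bijective_iff_injective_and_card _).2 ⟨fun β β' h => ?_, by simp⟩
    exact BitGadget.bitsVal_injective L (by simpa using congrArg Fin.val h))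

/-- The index of a bit-vector is its value. [cite: ChatterjeeTengse2023, Def. 2.27 (v1: Def. 34; p0011.txt:L82)] -/
@[simp] theorem bitsIndex_apply_val (L : ℕ) (β : Fin L → Bool) :
    ((bitsIndex L β : Fin (2 ^ L)) : ℕ) = BitGadget.bitsVal L β := rfl

/-- **The enumeration of the box `[2^δ]^n` by column indices**: index `j < 2^{nδ}` ↦ the digit
vector of its bits. [cite: ChatterjeeTengse2023, proof of Lemma 3.5 (v1: Lemma 42; p0015.txt:L80–L82)] -/
def blockEnum (n δ : ℕ) (j : Fin (2 ^ (n * δ))) : Fin n →₀ ℕ :=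
  blockExp n δ ((bitsIndex (n * δ)).symm j)

/-- The enumeration is injective. [cite: ChatterjeeTengse2023, proof of Lemma 3.5 (v1: Lemma 42; p0015.txt:L80–L82)] -/
theorem blockEnum_injective (n δ : ℕ) : Function.Injective (blockEnum n δ) :=
  (blockExp_injective n δ).comp (bitsIndex (n * δ)).symm.injective

/-- Enumerated digits are `< 2^δ`. [cite: ChatterjeeTengse2023, proof of Lemma 3.5 (v1: Lemma 42; p0015.txt:L80–L82)] -/
theorem blockEnum_lt (n δ : ℕ) (j : Fin (2 ^ (n * δ))) (t : Fin n) : blockEnum n δ j t < 2 ^ δ :=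
  blockExp_lt n δ _ t

/-- The enumeration read at the index of a bit-vector is its digit vector.
[cite: ChatterjeeTengse2023, proof of Lemma 3.5 (v1: Lemma 42; p0015.txt:L80–L82)] -/
@[simp] theorem blockEnum_bitsIndex (n δ : ℕ) (β : Fin (n * δ) → Bool) :
    blockEnum n δ (bitsIndex (n * δ) β) = blockExp n δ β := by
  simp [blockEnum]

end Blocks

/-! ### The parameters of Thm. 3.1: `n = 2m` outputs, `D = 2^δ ≤ 3md < 2D` -/

section Parameters

/-- `4^m ≤ m! · 3^m` for `m ≥ 2`. [folklore] -/
private theorem four_pow_le_factorial_mul_three_pow {m : ℕ} (hm : 2 ≤ m) : 4 ^ m ≤ m.factorial * 3 ^ m := by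
  induction m with
  | zero => omega
  | succ k ih =>
    rcases Nat.lt_or_ge k 2 with hk | hk
    · interval_cases k
      · omega
      · decide
    · have := ih hk
      rw [pow_succ, pow_succ, Nat.factorial_succ]
      have h1 : 4 ^ k * 4 ≤ k.factorial * 3 ^ k * 4 := Nat.mul_le_mul_right 4 this
      have h2 : k.factorial * 3 ^ k * 4 ≤ (k + 1) * k.factorial * (3 ^ k * 3) := by
        have h3 : 4 ≤ 3 * (k + 1) := by omega
        calc k.factorial * 3 ^ k * 4 ≤ k.factorial * 3 ^ k * (3 * (k + 1)) :=
              Nat.mul_le_mul_left _ h3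
          _ = (k + 1) * k.factorial * (3 ^ k * 3) := by ring
      exact h1.trans h2

/-- **The count at the parameters of Thm. 3.1.** For `m ≥ 2`, `d ≥ 1` and `3md < 2D` the number
of `m`-variate monomials of total degree `≤ 2m(D−1)d` is `< D^{2m}`:
`m! · binom(T+m, m) ≤ (T+m)^m < (2mdD)^m = (4md)^m D^m / 2^m ≤ m! D^{2m}` with `T = 2m(D−1)d`.
[cite: ChatterjeeTengse2023, proof of Lemma 3.2 "`M` has fewer rows than columns whenever …" and §3.3 (v1: p0014.txt:L50–L52, p0016.txt:L14–L16)] -/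
theorem choose_lt_pow_of_param {m d D : ℕ} (hm : 2 ≤ m) (hd : 1 ≤ d) (hD : 3 * m * d < 2 * D) :
    (m + 2 * m * (D - 1) * d).choose (2 * m * (D - 1) * d) < D ^ (2 * m) := by
  set T := 2 * m * (D - 1) * d with hT
  have hD1 : 1 ≤ D := by omega
  -- `m! · C(m+T, T) = (T+1)(T+2)⋯(T+m) ≤ (T+m)^m`
  have h1 : m.factorial * (m + T).choose T ≤ (T + m) ^ m := by
    have h := Nat.ascFactorial_eq_factorial_mul_choose T m
    have hch : (T + m).choose m = (m + T).choose T := by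
      rw [Nat.add_comm T m, Nat.choose_symm_add]
    rw [← hch, ← h]
    exact Nat.ascFactorial_le_pow_add T m
  -- `T + m < 2 m d D`
  have h2 : T + m < 2 * m * d * D := by
    have hmd : m ≤ m * d := Nat.le_mul_of_pos_right m hd
    have hpos : 0 < m * d := Nat.mul_pos (by omega) hd
    have hkey : T + 2 * (m * d) = 2 * m * d * D := by
      rw [hT]
      have hD' : D = (D - 1) + 1 := (Nat.sub_add_cancel hD1).symm
      conv_rhs => rw [hD']
      ring
    omega
  have h3 : (T + m) ^ m < (2 * m * d * D) ^ m :=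
    Nat.pow_lt_pow_left h2 (by omega)
  -- `(4md)^m ≤ m! (3md)^m ≤ m! (2D)^m`, i.e. `2^m (2md)^m D^m ≤ m! 2^m D^{2m}`
  have h4 : (2 * m * d * D) ^ m * 2 ^ m ≤ m.factorial * D ^ (2 * m) * 2 ^ m := by
    have h5 : (4 * (m * d)) ^ m ≤ m.factorial * (3 * (m * d)) ^ m :=
      calc (4 * (m * d)) ^ m = 4 ^ m * (m * d) ^ m := mul_pow 4 (m * d) m
        _ ≤ m.factorial * 3 ^ m * (m * d) ^ m :=
            Nat.mul_le_mul_right _ (four_pow_le_factorial_mul_three_pow hm)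
        _ = m.factorial * (3 * (m * d)) ^ m := by rw [mul_pow 3 (m * d) m]; ring
    have h6 : (3 * (m * d)) ^ m ≤ (2 * D) ^ m :=
      Nat.pow_le_pow_left (by rw [← mul_assoc]; exact hD.le) m
    calc (2 * m * d * D) ^ m * 2 ^ m = (4 * (m * d)) ^ m * D ^ m := by
          rw [← mul_pow, ← mul_pow]; congr 1; ring
      _ ≤ m.factorial * (3 * (m * d)) ^ m * D ^ m := Nat.mul_le_mul_right _ h5
      _ ≤ m.factorial * (2 * D) ^ m * D ^ m :=
          Nat.mul_le_mul_right _ (Nat.mul_le_mul_left _ h6)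
      _ = m.factorial * D ^ (2 * m) * 2 ^ m := by rw [mul_pow, two_mul, pow_add]; ring
  have h7 : m.factorial * (m + T).choose T * 2 ^ m < m.factorial * D ^ (2 * m) * 2 ^ m :=
    calc m.factorial * (m + T).choose T * 2 ^ m ≤ (T + m) ^ m * 2 ^ m :=
          Nat.mul_le_mul_right _ h1
      _ < (2 * m * d * D) ^ m * 2 ^ m := Nat.mul_lt_mul_of_pos_right h3 (by positivity)
      _ ≤ m.factorial * D ^ (2 * m) * 2 ^ m := h4
  have hf : 0 < m.factorial * 2 ^ m := by positivity
  by_contra hle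
  rw [not_lt] at hle
  have : m.factorial * D ^ (2 * m) * 2 ^ m ≤ m.factorial * (m + T).choose T * 2 ^ m :=
    Nat.mul_le_mul_right _ (Nat.mul_le_mul_left _ hle)
  omega

/-- **A power of two in `(3md/2, 3md]`**: for `md ≥ 1` there is `δ` with `2^δ ≤ 3md < 2^{δ+1}`
(take `δ = log₂(3md)`). [folklore] -/
private theorem exists_two_pow_param {m d : ℕ} (hm : 1 ≤ m) (hd : 1 ≤ d) :
    ∃ δ : ℕ, 2 ^ δ ≤ 3 * m * d ∧ 3 * m * d < 2 * 2 ^ δ := by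
  refine ⟨Nat.log 2 (3 * m * d), Nat.pow_log_le_self 2 ?_, ?_⟩
  · have : 0 < 3 * m * d := by positivity
    omega
  · have := Nat.lt_pow_succ_log_self (b := 2) (by norm_num) (3 * m * d)
    rw [pow_succ] at this
    omega

variable {m : ℕ}

/-- **The explicit-column annihilator at the parameters of Thm. 3.1.** For a polynomial map
`G : F^m → F^{2m}` of degree `≤ d` (`m ≥ 2`, `d ≥ 1`) over a field of characteristic `0` there are
`δ` with `2^δ ≤ 3md`, a prefix length `K` (`K + 1 ≤ 2^{2mδ}`) and `α` such that the matrix `M̃`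
with COLUMNS the digit vectors `blockEnum (2m) δ j`, `j ≤ K` (block `t` of the bits of `j` = the
binary expansion of the exponent of `x_t`), ROWS the evaluations of the column powers of `G` at the
Kronecker points `kronPoint Δ (α^{i+1})`, `Δ = 2m(2^δ−1)d + 1`, `i < K`, plus the symbolic row,
satisfies: `det M̃ ≠ 0`, `det M̃` has individual degree `< 2^δ ≤ 3md`, and `(det M̃) ∘ G = 0`.
This is the matrix the explicit encoder of Lemma 3.5 (v1 Lemma 42) computes entrywise.
[cite: ChatterjeeTengse2023, Lemma 3.2, Lemma 3.5 and §3.3 (v1: Lemma 39, Lemma 42, p0014.txt:L16–L60, p0015.txt:L57–L102, p0016.txt:L10–L22)] -/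
theorem exists_prefix_annihilator_blocks [CharZero F] {d : ℕ} (hm : 2 ≤ m) (hd : 1 ≤ d)
    (G : Fin (2 * m) → MvPolynomial (Fin m) F) (hG : ∀ i, (G i).totalDegree ≤ d) :
    ∃ (δ K : ℕ) (hK : K + 1 ≤ 2 ^ (2 * m * δ)) (α : F),
      2 ^ δ ≤ 3 * m * d ∧
      (annMatrix (Matrix.of fun (i : Fin K) (j : Fin (K + 1)) =>
          eval (kronPoint (2 * m * (2 ^ δ - 1) * d + 1) (α ^ ((i : ℕ) + 1)))
            (∏ t, G t ^ blockEnum (2 * m) δ (Fin.castLE hK j) t))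
        (blockEnum (2 * m) δ ∘ Fin.castLE hK)).det ≠ 0 ∧
      (∀ t, (annMatrix (Matrix.of fun (i : Fin K) (j : Fin (K + 1)) =>
          eval (kronPoint (2 * m * (2 ^ δ - 1) * d + 1) (α ^ ((i : ℕ) + 1)))
            (∏ t, G t ^ blockEnum (2 * m) δ (Fin.castLE hK j) t))
        (blockEnum (2 * m) δ ∘ Fin.castLE hK)).det.degreeOf t < 2 ^ δ) ∧
      aeval G (annMatrix (Matrix.of fun (i : Fin K) (j : Fin (K + 1)) =>
          eval (kronPoint (2 * m * (2 ^ δ - 1) * d + 1) (α ^ ((i : ℕ) + 1)))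
            (∏ t, G t ^ blockEnum (2 * m) δ (Fin.castLE hK j) t))
        (blockEnum (2 * m) δ ∘ Fin.castLE hK)).det = 0 := by
  classical
  obtain ⟨δ, hδle, hδlt⟩ := exists_two_pow_param (m := m) (by omega) hd
  have hcount : (m + 2 * m * (2 ^ δ - 1) * d).choose (2 * m * (2 ^ δ - 1) * d) < 2 ^ (2 * m * δ) := by
    have := choose_lt_pow_of_param hm hd hδlt
    rwa [← pow_mul, mul_comm δ] at this
  have hdep := not_linearIndependent_prod_pow_of_choose_lt G hG (blockEnum (2 * m) δ)
    (fun j t => blockEnum_lt _ _ j t) hcount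
  have hbox : ∀ j, ∀ c ∈ (∏ t, G t ^ blockEnum (2 * m) δ j t).support, ∀ b,
      c b < 2 * m * (2 ^ δ - 1) * d + 1 :=
    fun j c hc b => box_of_mem_support_prod_pow G hG (fun t => blockEnum_lt _ _ j t) hc b
  obtain ⟨K, hK, α, hdet, hann⟩ :=
    exists_annihilator_eq_det_annMatrix_prefix G (blockEnum (2 * m) δ) (blockEnum_injective _ _)
      hbox hdep
  refine ⟨δ, K, hK, α, hδle, hdet, fun t => ?_, hann⟩
  exact degreeOf_det_annMatrix_lt _ (by positivity) (fun j t => blockEnum_lt _ _ _ t) t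

end Parameters

/-! ### The prefix data DEFINED from `G` and the enumeration; `α`-uniform statements
(interface for the assembly seat: the minimal dependent prefix and its matrices as definitions,
the annihilation and degree claims for EVERY `α`, non-vanishing from the Kronecker prefix minor,
and the existence of a good `α` separately; general number of outputs `n'` under the count
hypothesis, `δ = 1` — the multilinear box — included) -/

section PrefixData

variable {m n : ℕ}

/-- **The length `K` of the shortest dependent prefix** of the powers `G^{exps j}` ("`K−1` is the
largest number for which the first `K−1` columns are linearly independent"; the tree's `K` counts
the independent columns, the dependent one is the `(K+1)`-st).
[cite: ChatterjeeTengse2023, proof of Lemma 3.2 (v1: Lemma 39; p0014.txt:L53–L55)] -/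
def prefixLen {N : ℕ} (G : Fin n → MvPolynomial (Fin m) F) (exps : Fin N → (Fin n →₀ ℕ))
    (hdep : ¬ LinearIndependent F (fun j => ∏ t, G t ^ exps j t)) : ℕ :=
  Classical.choose (exists_minimal_dependent_prefix _ hdep)

/-- The prefix fits: `K + 1 ≤ N`. [cite: ChatterjeeTengse2023, proof of Lemma 3.2 (v1: p0014.txt:L53–L56)] -/
theorem prefixLen_succ_le {N : ℕ} (G : Fin n → MvPolynomial (Fin m) F) (exps : Fin N → (Fin n →₀ ℕ))
    (hdep : ¬ LinearIndependent F (fun j => ∏ t, G t ^ exps j t)) : prefixLen G exps hdep + 1 ≤ N :=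
  (Classical.choose_spec (exists_minimal_dependent_prefix _ hdep)).1

/-- The first `K` powers are linearly independent. [cite: ChatterjeeTengse2023, proof of Lemma 3.2 (v1: p0014.txt:L53–L60)] -/
theorem linearIndependent_prefix {N : ℕ} (G : Fin n → MvPolynomial (Fin m) F)
    (exps : Fin N → (Fin n →₀ ℕ)) (hdep : ¬ LinearIndependent F (fun j => ∏ t, G t ^ exps j t)) :
    LinearIndependent F ((fun j => ∏ t, G t ^ exps j t) ∘
      Fin.castLE (Nat.le_of_succ_le (prefixLen_succ_le G exps hdep))) :=
  (Classical.choose_spec (exists_minimal_dependent_prefix _ hdep)).2.1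

/-- The `(K+1)`-st power lies in the span of the first `K`. [cite: ChatterjeeTengse2023, proof of Lemma 3.2 (v1: p0014.txt:L58–L60)] -/
theorem mem_span_prefix {N : ℕ} (G : Fin n → MvPolynomial (Fin m) F)
    (exps : Fin N → (Fin n →₀ ℕ)) (hdep : ¬ LinearIndependent F (fun j => ∏ t, G t ^ exps j t)) :
    (∏ t, G t ^ exps ⟨prefixLen G exps hdep, prefixLen_succ_le G exps hdep⟩ t) ∈
      Submodule.span F (Set.range ((fun j => ∏ t, G t ^ exps j t) ∘
        Fin.castLE (Nat.le_of_succ_le (prefixLen_succ_le G exps hdep)))) :=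
  (Classical.choose_spec (exists_minimal_dependent_prefix _ hdep)).2.2

/-- **The Kronecker prefix minor**: the `K × K` evaluation matrix of the independent prefix at the
Kronecker points `kronPoint Δ (α^{i+1})` (the source's `M' ∖ M'[*, e^{(K)}]`).
[cite: ChatterjeeTengse2023, Claims 3.3–3.4 (v1: Claims 40–41; p0014.txt:L78–L92, p0015.txt:L16–L32)] -/
def kronMinor {N : ℕ} (G : Fin n → MvPolynomial (Fin m) F) (exps : Fin N → (Fin n →₀ ℕ))
    (hdep : ¬ LinearIndependent F (fun j => ∏ t, G t ^ exps j t)) (Δ : ℕ) (α : F) :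
    Matrix (Fin (prefixLen G exps hdep)) (Fin (prefixLen G exps hdep)) F :=
  Matrix.of fun i j => eval (kronPoint Δ (α ^ ((i : ℕ) + 1)))
    (∏ t, G t ^ exps (Fin.castLE (Nat.le_of_succ_le (prefixLen_succ_le G exps hdep)) j) t)

/-- **The prefix matrix `M̃`** at the scalar `α`: rows the Kronecker evaluations of the first
`K+1` powers, last row symbolic (t18's `annMatrix`).
[cite: ChatterjeeTengse2023, Lemma 3.2, matrix `M̃` (v1: Lemma 39; p0015.txt:L3–L9)] -/
def prefixAnnMatrix {N : ℕ} (G : Fin n → MvPolynomial (Fin m) F) (exps : Fin N → (Fin n →₀ ℕ))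
    (hdep : ¬ LinearIndependent F (fun j => ∏ t, G t ^ exps j t)) (Δ : ℕ) (α : F) :
    Matrix (Fin (prefixLen G exps hdep + 1)) (Fin (prefixLen G exps hdep + 1)) (MvPolynomial (Fin n) F) :=
  annMatrix (Matrix.of fun (i : Fin (prefixLen G exps hdep)) (j : Fin (prefixLen G exps hdep + 1)) =>
      eval (kronPoint Δ (α ^ ((i : ℕ) + 1)))
        (∏ t, G t ^ exps (Fin.castLE (prefixLen_succ_le G exps hdep) j) t))
    (exps ∘ Fin.castLE (prefixLen_succ_le G exps hdep))

/-- **`det M̃` annihilates `G` — for EVERY `α`** (only the column dependency is used).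
[cite: ChatterjeeTengse2023, Claim 3.4 (v1: Claim 41; p0015.txt:L16–L32)] -/
theorem aeval_det_prefixAnnMatrix {N : ℕ} (G : Fin n → MvPolynomial (Fin m) F)
    (exps : Fin N → (Fin n →₀ ℕ)) (hdep : ¬ LinearIndependent F (fun j => ∏ t, G t ^ exps j t))
    (Δ : ℕ) (α : F) : aeval G (prefixAnnMatrix G exps hdep Δ α).det = 0 := by
  classical
  set K := prefixLen G exps hdep with hKdef
  have hK : K + 1 ≤ N := prefixLen_succ_le G exps hdep
  set e : Fin (K + 1) → (Fin n →₀ ℕ) := exps ∘ Fin.castLE hK with he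
  set P : Fin (K + 1) → MvPolynomial (Fin m) F := fun j => ∏ t, G t ^ e j t with hP
  have hPcast : P ∘ Fin.castSucc =
      (fun j : Fin N => ∏ t, G t ^ exps j t) ∘ Fin.castLE (Nat.le_of_succ_le hK) := by
    funext j; rfl
  have hPlast : P (Fin.last K) ∈ Submodule.span F (Set.range (P ∘ Fin.castSucc)) := by
    rw [hPcast]; exact mem_span_prefix G exps hdep
  obtain ⟨c, hc⟩ := (Submodule.mem_span_range_iff_exists_fun F).1 hPlast
  have hPe_mon : ∀ j, aeval G (monomial (e j) (1 : F)) = P j := fun j => by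
    rw [aeval_monomial, map_one, one_mul, Finsupp.prod_pow]
  refine map_det_annMatrix_eq_zero _ e (P := P) (aeval G) hPe_mon
    (p := fun i => kronPoint Δ (α ^ ((i : ℕ) + 1))) (fun i j => rfl)
    (f := Fin.snoc c (-1)) ?_ (j₀ := Fin.last K) (by simp)
  rw [Fin.sum_univ_castSucc]
  simp only [Fin.snoc_castSucc, Fin.snoc_last, neg_smul, one_smul]
  rw [show (∑ i : Fin K, c i • P (Fin.castSucc i)) = P (Fin.last K) from hc, add_neg_cancel]

/-- **`det M̃ ≠ 0` as soon as the Kronecker prefix minor at `α` is nonzero.**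
[cite: ChatterjeeTengse2023, Claims 3.3–3.4 (v1: Claims 40–41; p0015.txt:L16–L32)] -/
theorem det_prefixAnnMatrix_ne_zero {N : ℕ} (G : Fin n → MvPolynomial (Fin m) F)
    (exps : Fin N → (Fin n →₀ ℕ)) (hinj : Function.Injective exps)
    (hdep : ¬ LinearIndependent F (fun j => ∏ t, G t ^ exps j t)) (Δ : ℕ) {α : F}
    (hα : (kronMinor G exps hdep Δ α).det ≠ 0) : (prefixAnnMatrix G exps hdep Δ α).det ≠ 0 := by
  have hK := prefixLen_succ_le G exps hdep
  refine det_annMatrix_ne_zero _ (hinj.comp (Fin.castLE_injective hK))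
    (j₀ := Fin.last (prefixLen G exps hdep)) ?_
  have : (Matrix.of fun (i : Fin (prefixLen G exps hdep)) (j : Fin (prefixLen G exps hdep + 1)) =>
        eval (kronPoint Δ (α ^ ((i : ℕ) + 1)))
          (∏ t, G t ^ exps (Fin.castLE hK j) t)).submatrix id
        (Fin.last (prefixLen G exps hdep)).succAbove = kronMinor G exps hdep Δ α := by
    ext i j; simp [kronMinor, Fin.succAbove_last]
  rw [this]; exact hα

/-- **Individual degree of `det M̃` — for every `α`**: below `D` if all enumerated digits are.
[cite: ChatterjeeTengse2023, proof of Lemma 3.2 (v1: p0015.txt:L32–L33)] -/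
theorem degreeOf_det_prefixAnnMatrix_lt {N D : ℕ} (G : Fin n → MvPolynomial (Fin m) F)
    (exps : Fin N → (Fin n →₀ ℕ)) (hdep : ¬ LinearIndependent F (fun j => ∏ t, G t ^ exps j t))
    (hD : 0 < D) (hexps : ∀ j t, exps j t < D) (Δ : ℕ) (α : F) (t : Fin n) :
    (prefixAnnMatrix G exps hdep Δ α).det.degreeOf t < D :=
  degreeOf_det_annMatrix_lt _ hD (fun _ t => hexps _ t) t

/-- **A good `α` exists** (characteristic `0`): the Kronecker prefix minor is nonzero for some
field element `α` (t18's rank extractor `exists_kronecker_det_eval_ne_zero`; an INTEGER `α` below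
`D^{2n}` — the source's bound — is not tracked here).
[cite: ChatterjeeTengse2023, Claim 3.3 (v1: Claim 40; p0014.txt:L78–L92)] -/
theorem exists_kronMinor_det_ne_zero [CharZero F] {N Δ : ℕ} (G : Fin n → MvPolynomial (Fin m) F)
    (exps : Fin N → (Fin n →₀ ℕ)) (hdep : ¬ LinearIndependent F (fun j => ∏ t, G t ^ exps j t))
    (hbox : ∀ j, ∀ c ∈ (∏ t, G t ^ exps j t).support, ∀ b, c b < Δ) :
    ∃ α : F, (kronMinor G exps hdep Δ α).det ≠ 0 := by
  have hind := linearIndependent_prefix G exps hdep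
  obtain ⟨α, hα⟩ := exists_kronecker_det_eval_ne_zero Δ hind (fun j c hc b => hbox _ c hc b)
  exact ⟨α, by simpa [kronMinor] using hα⟩

/-- The total-degree count makes the bit-block family dependent, for ANY number of outputs `n`
and block width `δ` (including `δ = 1`, the multilinear box `{0,1}^n`).
[cite: ChatterjeeTengse2023, proof of Lemma 3.2 (v1: p0014.txt:L46–L52)] -/
theorem not_linearIndependent_blockEnum {d δ : ℕ} (G : Fin n → MvPolynomial (Fin m) F)
    (hG : ∀ i, (G i).totalDegree ≤ d)
    (hcount : (m + n * (2 ^ δ - 1) * d).choose (n * (2 ^ δ - 1) * d) < 2 ^ (n * δ)) :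
    ¬ LinearIndependent F (fun j => ∏ t, G t ^ blockEnum n δ j t) :=
  not_linearIndependent_prod_pow_of_choose_lt G hG (blockEnum n δ) (fun j t => blockEnum_lt _ _ j t) hcount

/-- The powers along the bit-block enumeration have individual degree `< n(2^δ−1)d + 1`.
[cite: ChatterjeeTengse2023, proof of Lemma 3.2 (v1: p0014.txt:L49–L50)] -/
theorem box_blockEnum {d δ : ℕ} (G : Fin n → MvPolynomial (Fin m) F) (hG : ∀ i, (G i).totalDegree ≤ d)
    (j : Fin (2 ^ (n * δ))) : ∀ c ∈ (∏ t, G t ^ blockEnum n δ j t).support, ∀ b,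
      c b < n * (2 ^ δ - 1) * d + 1 :=
  fun _ hc b => box_of_mem_support_prod_pow G hG (fun t => blockEnum_lt _ _ j t) hc b

/-- **The explicit-column annihilator for a general number of outputs** (R1 of the assembly
seat): under the count hypothesis, for every block width `δ`, there are a prefix length `K` and
`α` with `det M̃ ≠ 0`, individual degree `< 2^δ`, `(det M̃) ∘ G = 0` — `M̃ = prefixAnnMatrix` of the
bit-block enumeration. [cite: ChatterjeeTengse2023, Lemma 3.2 with Lemma 3.5 (v1: Lemma 39, Lemma 42)] -/
theorem exists_prefix_annihilator_blocks_of_count [CharZero F] {d δ : ℕ}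
    (G : Fin n → MvPolynomial (Fin m) F) (hG : ∀ i, (G i).totalDegree ≤ d)
    (hcount : (m + n * (2 ^ δ - 1) * d).choose (n * (2 ^ δ - 1) * d) < 2 ^ (n * δ)) :
    ∃ α : F,
      (prefixAnnMatrix G (blockEnum n δ) (not_linearIndependent_blockEnum G hG hcount)
          (n * (2 ^ δ - 1) * d + 1) α).det ≠ 0 ∧
      (∀ t, (prefixAnnMatrix G (blockEnum n δ) (not_linearIndependent_blockEnum G hG hcount)
          (n * (2 ^ δ - 1) * d + 1) α).det.degreeOf t < 2 ^ δ) ∧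
      aeval G (prefixAnnMatrix G (blockEnum n δ) (not_linearIndependent_blockEnum G hG hcount)
          (n * (2 ^ δ - 1) * d + 1) α).det = 0 := by
  obtain ⟨α, hα⟩ := exists_kronMinor_det_ne_zero G (blockEnum n δ)
    (not_linearIndependent_blockEnum G hG hcount) (box_blockEnum G hG)
  exact ⟨α, det_prefixAnnMatrix_ne_zero G _ (blockEnum_injective _ _) _ _ hα,
    fun t => degreeOf_det_prefixAnnMatrix_lt G _ _ (by positivity) (fun j t => blockEnum_lt _ _ j t) _ α t,
    aeval_det_prefixAnnMatrix G _ _ _ α⟩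

/-- The parameters of Thm. 3.1 satisfy the count hypothesis: `m ≥ 2`, `d ≥ 1`, `n = 2m`,
`2^δ ≤ 3md < 2^{δ+1}` (restating `choose_lt_pow_of_param` in the shape of `hcount`).
[cite: ChatterjeeTengse2023, §3.3 (v1: p0016.txt:L10–L16)] -/
theorem count_of_param {m d δ : ℕ} (hm : 2 ≤ m) (hd : 1 ≤ d) (hδ : 3 * m * d < 2 * 2 ^ δ) :
    (m + 2 * m * (2 ^ δ - 1) * d).choose (2 * m * (2 ^ δ - 1) * d) < 2 ^ (2 * m * δ) := by
  have := choose_lt_pow_of_param hm hd hδ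
  rwa [← pow_mul, mul_comm δ] at this

/-- A block width for Thm. 3.1: `2^δ ≤ 3md < 2^{δ+1}` (public form of the private helper).
[cite: ChatterjeeTengse2023, §3.3 (v1: p0016.txt:L10–L16)] -/
theorem exists_blockWidth {m d : ℕ} (hm : 1 ≤ m) (hd : 1 ≤ d) :
    ∃ δ : ℕ, 2 ^ δ ≤ 3 * m * d ∧ 3 * m * d < 2 * 2 ^ δ :=
  exists_two_pow_param hm hd

end PrefixData

end Literature.Barriers.ValiantsHypothesis
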